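import Literature.Analysis.FluidPDE.PassiveVectorTensorDistortedConstFrameGalerkinTail
import Literature.Analysis.FluidPDE.PassiveVectorTensorGalerkinIdentity
import HarnessLib

/-!
# The distorted weak class with a CONSTANT frame: the truncated energy identity (Fourier form), the
# flux against the own truncation, and the coercivity of the twisted symbol form (frozen-frame twin of
# `PassiveVectorTensorGalerkinIdentity`)

Analysis/FluidPDE proof-support file (everything proved; no definitions, no named facts). Fourth brick
(layer L3, file 4/5) of the Fourier–Galerkin energy argument ON THE WEAK SOLUTION ITSELF for the
constant-frame distorted class `Torus.IsWeakTensorPassiveVectorDistortedOn A T 𝔸 b (fun _ _ => G₀) w₀ w`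
(`∂ₜw + (b·∇)w + A (w·∇)b + G₀ᵀ∇π = 𝓛^{G₀} w`, `∇·(G₀ w) = 0`).  The viscous side is the symbol form of the
CONJUGATED tensor, `Q_N(s) = 4π² ∑_{|k|≤N} Re ⟪ŵ(s)(k), T_{𝔸^{G₀}}(k) ŵ(s)(k)⟫`,
`T_{𝔸^{G₀}}(k) = Torus.symbT (Visc4.conj G₀ 𝔸) k`, coercive on the twisted planes `(G₀ᵀk)^⊥` where the
modes of `w(s)` lie (`lo |G₀ᵀk|² ‖z‖² ≤ Re ⟪z, T_{𝔸^{G₀}}(k) z⟫`, `PassiveVectorTensorTwistedModalSymbol`);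
the transport side (flux against the own truncation, remainder form and bound) is frame-independent:

* `ae_galerkinFlux_eq_sum` (any frame) — the transport flux against the own truncation in Fourier
  variables: `∫⟪w(s),(b(s)·∇)P_N w(s)⟫ + A∫⟪b(s),(w(s)·∇)P_N w(s)⟫ = ∑_{|k|≤N} Re B_k(ŵ(s)(k))(s)` a.e.;
* `integrableOn_galerkinFlux` (any frame), `integrableOn_symbForm` (any frame, any tensor `𝔹`);
* **`ae_sum_sq_norm_mFourierCoeff_eq_constFrame`** — the truncated energy identity: for a datum
  `w₀ ∈ L²` with `∇·(G₀ w₀) = 0` weakly, a.e. `t ∈ (0,T)` and every `N`,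
  `∑_{|k|≤N} ‖ŵ(t)(k)‖² + 2∫_{(0,t]} Q_N = ∑_{|k|≤N} ‖ŵ₀(k)‖² + 2∫_{(0,t]} Flux_N`
  (the one-mode identities `…ConstFrameModeEnergy.ae_sq_norm_mFourierCoeff_eq_constFrame` summed over
  the frequency ball; Robinson–Rodrigo–Sadowski 2016, §4.2 (4.20), with Frisch's tensor conjugated by
  the frozen frame);
* `ae_galerkinFlux_eq_remainder` (any frame) — for `A = 0` and a carrier bounded by `M`:
  `Flux_N(s) = R_N(s) = ∫⟪w(s) − P_N w(s), (b(s)·∇)P_N w(s)⟫`,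
  `|R_N(s)| ≤ d M (∫‖w(s) − P_N w(s)‖²)^{1/2} ‖∇P_N w(s)‖₂`;
* **`ae_lo_mul_le_symbForm_constFrame`** — coercivity of the truncated twisted symbol form against the
  flat truncated dissipation for a NON-DEGENERATE frame (`c|k|² ≤ |G₀ᵀk|²`, `0 ≤ c`, `0 ≤ lo`):
  `(lo c) ‖∇P_N w(s)‖₂² ≤ Q_N(s)`; on mean-zero slices `4π² (lo c) ∑_{|k|≤N} ‖ŵ(s)(k)‖² ≤ Q_N(s)`
  (`ae_lo_mul_sum_sq_norm_le_symbForm_constFrame`); `Q_N(s)` has nonnegative terms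
  (`ae_re_inner_symbT_nonneg_constFrame`, `0 ≤ lo`, any frame constant) and is nondecreasing in `N`
  (`ae_symbForm_mono_constFrame`).

Cell `ad-ideate`, route `SolenoidalFractalHomogenisation`, K1L_D stmt-AnomalousDissipation-27980, road of
record D28-7 layer L3 («frozen-frame energy of every weak solution», registered stub `stub_D1_V0θg`);
Armstrong–Vicol's Lagrangian-coordinate ansatz with the distortion frozen (arXiv:2305.05048 §4.1).

## Mathlib / tree search

Tree: `PassiveVectorTensorGalerkinIdentity` (flat twin, verbatim up to the two substitutions),
`PassiveVectorGalerkinIdentity` (`sum_mul_integral_inner_convect_eq`,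
`integral_inner_convect_fourierTruncate_eq_remainder`, `abs_integral_inner_convect_le_of_norm_le`,
`gradNormSq_fourierTruncate`), `PassiveVectorFourier` (`integral_inner_convect_realTrigPoly_singleton`),
`PassiveVectorTensorDistortedConstFrameModeEnergy`, `PassiveVectorTensorTwistedModalSymbol`
(`lo_mul_le_re_inner_symbT_conj`), `TorusTrigPoly` (`toReal_eGradNormSq_realTrigPoly`, `freqBall`),
`TorusFourierModes` (`realTrigPoly_apply_eq_sum`), `TorusInverseLaplacian` (`one_le_freqNormSq_of_ne_zero`).

## References

* J. C. Robinson, J. L. Rodrigo, W. Sadowski, *The three-dimensional Navier–Stokes equations*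
  (CUP 2016), §4.1–§4.2, (4.20). [`RobinsonRodrigoSadowski2016`]
* S. Armstrong, V. Vicol, *Anomalous diffusion by fractal homogenization*, Ann. PDE 11 (2025) /
  arXiv:2305.05048, §4.1 (PDF p. 34). [`ArmstrongVicol2025`]
* U. Frisch, *Turbulence* (CUP 1995), §9.6.3 eq. (9.57) p. 233. [`Frisch1995Turbulence`]
* M. Giaquinta, *Multiple integrals in the calculus of variations and nonlinear elliptic systems*
  (Princeton 1983), Ch. III §2 (2.2). [`Giaquinta1983MultipleIntegrals`]
* R. Temam, *Navier–Stokes Equations* (1984), Ch. III §1.1. [`Temam1984`]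
-/

noncomputable section

open MeasureTheory Set Filter Function TopologicalSpace Complex UnitAddTorus
open scoped ENNReal NNReal InnerProductSpace ComplexConjugate

namespace Literature.Analysis.FluidPDE

namespace Torus

variable {d : Type*} [Fintype d] [DecidableEq d]

/-! ## The truncation as a sum of single real modes -/

section Truncation

/-- `P_N u = ∑_{|k|≤N} Re (e_k • û(k))` as a sum of single real modes. [folklore] -/
private theorem fourierTruncate_eq_sum_singleton_cf (N : ℕ) (u : UnitAddTorus d → EuclideanSpace ℝ d) :
    FunctionSpaces.Torus.fourierTruncate N u = fun y => ∑ k ∈ FunctionSpaces.Torus.freqBall N,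
      (1 : ℝ) • FunctionSpaces.Torus.realTrigPoly {k}
        (fun k' => mFourierCoeff (FunctionSpaces.EuclideanSpace.complexify ∘ u) k') y := by
  funext y
  rw [FunctionSpaces.Torus.fourierTruncate_eq, FunctionSpaces.Torus.realTrigPoly_apply_eq_sum]
  refine Finset.sum_congr rfl fun k _ => ?_
  rw [one_smul, FunctionSpaces.Torus.realTrigPoly_apply_eq_sum, Finset.sum_singleton]

end Truncation

namespace IsWeakTensorPassiveVectorDistortedOn

variable {A T : ℝ} {𝔸 : Visc4 d} {b w : ℝ → UnitAddTorus d → EuclideanSpace ℝ d}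
  {G : ℝ → UnitAddTorus d → Matrix d d ℝ} {G₀ : Matrix d d ℝ} {w₀ : UnitAddTorus d → EuclideanSpace ℝ d}

/-! ## The transport flux against the own truncation, in Fourier variables (any frame) -/

/-- **The transport flux against the own truncation in Fourier variables** (any frame): for a.e.
`s ∈ (0,T)` and every `N`,
`∫⟪w(s),(b(s)·∇)P_N w(s)⟫ + A∫⟪b(s),(w(s)·∇)P_N w(s)⟫ = ∑_{|k|≤N} Re B_k(ŵ(s)(k))(s)`,
`B_k(z)(s) = ∑ⱼ 2πikⱼ ⟪𝓕(bⱼw)(s)(k), z⟫ + A ∑ⱼ 2πikⱼ ⟪𝓕(wⱼb)(s)(k), z⟫` (linearity of the trilinear form in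
the test field and the single-mode pairings). [cite: RobinsonRodrigoSadowski2016, §4.1 (Galerkin truncations)] -/
theorem ae_galerkinFlux_eq_sum (h : IsWeakTensorPassiveVectorDistortedOn A T 𝔸 b G w₀ w) :
    ∀ᵐ s ∂(volume.restrict (Ioo 0 T)), ∀ N : ℕ,
      (∫ x, ⟪w s x, FunctionSpaces.Torus.convect (b s) (FunctionSpaces.Torus.fourierTruncate N (w s)) x⟫_ℝ) +
          A * ∫ x, ⟪b s x, FunctionSpaces.Torus.convect (w s) (FunctionSpaces.Torus.fourierTruncate N (w s)) x⟫_ℝ =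
        ∑ k ∈ FunctionSpaces.Torus.freqBall N,
          ((∑ j, (2 * Real.pi * I * (k j)) *
              ⟪mFourierCoeff (FunctionSpaces.EuclideanSpace.complexify ∘ fun x => b s x j • w s x) k,
                mFourierCoeff (FunctionSpaces.EuclideanSpace.complexify ∘ w s) k⟫_ℂ) +
            (A : ℂ) * ∑ j, (2 * Real.pi * I * (k j)) *
              ⟪mFourierCoeff (FunctionSpaces.EuclideanSpace.complexify ∘ fun x => w s x j • b s x) k,
                mFourierCoeff (FunctionSpaces.EuclideanSpace.complexify ∘ w s) k⟫_ℂ).re := by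
  filter_upwards [h.ae_integrable_slice] with s hs
  intro N
  set c : (d → ℤ) → EuclideanSpace ℂ d := fun k' => mFourierCoeff (FunctionSpaces.EuclideanSpace.complexify ∘ w s) k'
    with hc
  have ha : ∀ k : d → ℤ, FunctionSpaces.Torus.IsSmooth (FunctionSpaces.Torus.realTrigPoly {k} c) :=
    fun k => FunctionSpaces.Torus.isSmooth_realTrigPoly _ _
  have e1 : ∫ x, ⟪w s x, FunctionSpaces.Torus.convect (b s) (FunctionSpaces.Torus.fourierTruncate N (w s)) x⟫_ℝ =
      ∑ k ∈ FunctionSpaces.Torus.freqBall N, (∑ j, (2 * Real.pi * I * (k j)) *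
        ⟪mFourierCoeff (FunctionSpaces.EuclideanSpace.complexify ∘ fun x => b s x j • w s x) k, c k⟫_ℂ).re := by
    rw [fourierTruncate_eq_sum_singleton_cf N (w s),
      ← sum_mul_integral_inner_convect_eq (FunctionSpaces.Torus.freqBall N) (fun _ => (1 : ℝ)) ha hs.2.1]
    refine Finset.sum_congr rfl fun k _ => ?_
    rw [one_mul, integral_inner_convect_realTrigPoly_singleton hs.2.1 k c]
  have e2 : ∫ x, ⟪b s x, FunctionSpaces.Torus.convect (w s) (FunctionSpaces.Torus.fourierTruncate N (w s)) x⟫_ℝ =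
      ∑ k ∈ FunctionSpaces.Torus.freqBall N, (∑ j, (2 * Real.pi * I * (k j)) *
        ⟪mFourierCoeff (FunctionSpaces.EuclideanSpace.complexify ∘ fun x => w s x j • b s x) k, c k⟫_ℂ).re := by
    rw [fourierTruncate_eq_sum_singleton_cf N (w s),
      ← sum_mul_integral_inner_convect_eq (FunctionSpaces.Torus.freqBall N) (fun _ => (1 : ℝ)) ha hs.2.2]
    refine Finset.sum_congr rfl fun k _ => ?_
    rw [one_mul, integral_inner_convect_realTrigPoly_singleton hs.2.2 k c]
  rw [e1, e2, Finset.mul_sum, ← Finset.sum_add_distrib]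
  refine Finset.sum_congr rfl fun k _ => ?_
  rw [Complex.add_re, Complex.re_ofReal_mul]

/-! ## Integrability of the truncated integrands (any frame) -/

/-- The transport flux against the own truncation is integrable on `(0,T)` (any frame).
[cite: RobinsonRodrigoSadowski2016, §4.2 (Galerkin energy estimate)] -/
theorem integrableOn_galerkinFlux (h : IsWeakTensorPassiveVectorDistortedOn A T 𝔸 b G w₀ w) (N : ℕ) :
    IntegrableOn (fun s =>
      (∫ x, ⟪w s x, FunctionSpaces.Torus.convect (b s) (FunctionSpaces.Torus.fourierTruncate N (w s)) x⟫_ℝ) +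
        A * ∫ x, ⟪b s x, FunctionSpaces.Torus.convect (w s) (FunctionSpaces.Torus.fourierTruncate N (w s)) x⟫_ℝ)
      (Ioo 0 T) volume := by
  have hsum : IntegrableOn (fun s => ∑ k ∈ FunctionSpaces.Torus.freqBall N,
      ((∑ j, (2 * Real.pi * I * (k j)) *
          ⟪mFourierCoeff (FunctionSpaces.EuclideanSpace.complexify ∘ fun x => b s x j • w s x) k,
            mFourierCoeff (FunctionSpaces.EuclideanSpace.complexify ∘ w s) k⟫_ℂ) +
        (A : ℂ) * ∑ j, (2 * Real.pi * I * (k j)) *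
          ⟪mFourierCoeff (FunctionSpaces.EuclideanSpace.complexify ∘ fun x => w s x j • b s x) k,
            mFourierCoeff (FunctionSpaces.EuclideanSpace.complexify ∘ w s) k⟫_ℂ).re) (Ioo 0 T) volume :=
    integrable_finsetSum _ fun k _ => (h.integrableOn_modeRHS_self k).re
  refine hsum.congr ?_
  filter_upwards [h.ae_galerkinFlux_eq_sum] with s hs
  exact (hs N).symm

/-- The truncated symbol form `s ↦ Q_N(s) = 4π² ∑_{|k|≤N} Re ⟪ŵ(s)(k), T_𝔹(k) ŵ(s)(k)⟫` is integrable on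
`(0,T)` for any tensor `𝔹` (used with `𝔹 = 𝔸^{G₀}`; any frame). [cite: Frisch1995Turbulence, §9.6.3 eq. (9.57) p. 233] -/
theorem integrableOn_symbForm (h : IsWeakTensorPassiveVectorDistortedOn A T 𝔸 b G w₀ w) (𝔹 : Visc4 d) (N : ℕ) :
    IntegrableOn (fun s => 4 * Real.pi ^ 2 * ∑ k ∈ FunctionSpaces.Torus.freqBall N,
      (⟪mFourierCoeff (FunctionSpaces.EuclideanSpace.complexify ∘ w s) k,
        symbT 𝔹 k (mFourierCoeff (FunctionSpaces.EuclideanSpace.complexify ∘ w s) k)⟫_ℂ).re) (Ioo 0 T) volume :=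
  (integrable_finsetSum _ fun k _ => (h.integrableOn_inner_symbT 𝔹 k).re).const_mul _

/-! ## The truncated energy identity (constant frame) -/

/-- **The truncated energy identity of a constant-frame distorted weak solution (Fourier form).** For a
datum `w₀ ∈ L²` with `∇·(G₀ w₀) = 0` weakly, a.e. `t ∈ (0,T)` and every `N`:
`∑_{|k|≤N} ‖ŵ(t)(k)‖² + 2 ∫_{(0,t]} Q_N(s) ds = ∑_{|k|≤N} ‖ŵ₀(k)‖² + 2 ∫_{(0,t]} Flux_N(s) ds`,
`Q_N(s) = 4π² ∑_{|k|≤N} Re ⟪ŵ(s)(k), T_{𝔸^{G₀}}(k) ŵ(s)(k)⟫`,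
`Flux_N(s) = ∫⟪w(s),(b(s)·∇)P_N w(s)⟫ + A ∫⟪b(s),(w(s)·∇)P_N w(s)⟫` — the twisted Galerkin system tested
against its own solution, obtained by summing the one-mode identities over the frequency ball.
[cite: RobinsonRodrigoSadowski2016, §4.2 (4.20)] [cite: ArmstrongVicol2025, §4.1 (PDF p. 34)]
[cite: Frisch1995Turbulence, §9.6.3 eq. (9.57) p. 233] -/
theorem ae_sum_sq_norm_mFourierCoeff_eq_constFrame (h : IsWeakTensorPassiveVectorDistortedOn A T 𝔸 b (fun _ _ => G₀) w₀ w)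
    (hw₀ : MemLp w₀ 2 volume) (hdiv₀ : FunctionSpaces.Torus.IsWeaklyDivFree (distort (fun _ => G₀) w₀)) :
    ∀ᵐ t ∂(volume.restrict (Ioo 0 T)), ∀ N : ℕ,
      (∑ k ∈ FunctionSpaces.Torus.freqBall N, ‖mFourierCoeff (FunctionSpaces.EuclideanSpace.complexify ∘ w t) k‖ ^ 2) +
          2 * ∫ s in Ioc 0 t, 4 * Real.pi ^ 2 * ∑ k ∈ FunctionSpaces.Torus.freqBall N,
            (⟪mFourierCoeff (FunctionSpaces.EuclideanSpace.complexify ∘ w s) k,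
              symbT (Visc4.conj G₀ 𝔸) k (mFourierCoeff (FunctionSpaces.EuclideanSpace.complexify ∘ w s) k)⟫_ℂ).re =
        (∑ k ∈ FunctionSpaces.Torus.freqBall N, ‖mFourierCoeff (FunctionSpaces.EuclideanSpace.complexify ∘ w₀) k‖ ^ 2) +
          2 * ∫ s in Ioc 0 t,
            ((∫ x, ⟪w s x, FunctionSpaces.Torus.convect (b s) (FunctionSpaces.Torus.fourierTruncate N (w s)) x⟫_ℝ) +
              A * ∫ x, ⟪b s x, FunctionSpaces.Torus.convect (w s) (FunctionSpaces.Torus.fourierTruncate N (w s)) x⟫_ℝ) := by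
  -- names
  set X : (d → ℤ) → ℝ → EuclideanSpace ℂ d := fun k t =>
    mFourierCoeff (FunctionSpaces.EuclideanSpace.complexify ∘ w t) k with hX
  set X₀ : (d → ℤ) → EuclideanSpace ℂ d := fun k =>
    mFourierCoeff (FunctionSpaces.EuclideanSpace.complexify ∘ w₀) k with hX₀
  set Bf : (d → ℤ) → ℝ → ℂ := fun k s =>
    (∑ j, (2 * Real.pi * I * (k j)) *
        ⟪mFourierCoeff (FunctionSpaces.EuclideanSpace.complexify ∘ fun x => b s x j • w s x) k, X k s⟫_ℂ) +
      (A : ℂ) * ∑ j, (2 * Real.pi * I * (k j)) *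
        ⟪mFourierCoeff (FunctionSpaces.EuclideanSpace.complexify ∘ fun x => w s x j • b s x) k, X k s⟫_ℂ with hBf
  set Vf : (d → ℤ) → ℝ → ℂ := fun k s => ⟪X k s, symbT (Visc4.conj G₀ 𝔸) k (X k s)⟫_ℂ with hVf
  set Fl : ℕ → ℝ → ℝ := fun N s =>
    (∫ x, ⟪w s x, FunctionSpaces.Torus.convect (b s) (FunctionSpaces.Torus.fourierTruncate N (w s)) x⟫_ℝ) +
      A * ∫ x, ⟪b s x, FunctionSpaces.Torus.convect (w s) (FunctionSpaces.Torus.fourierTruncate N (w s)) x⟫_ℝ with hFl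
  have hBi : ∀ k, IntegrableOn (fun s => (Bf k s).re) (Ioo 0 T) volume := fun k => (h.integrableOn_modeRHS_self k).re
  have hVi : ∀ k, IntegrableOn (fun s => (Vf k s).re) (Ioo 0 T) volume := fun k =>
    (h.integrableOn_inner_symbT (Visc4.conj G₀ 𝔸) k).re
  have hHi : ∀ k, IntegrableOn (fun s => ((-(4 * Real.pi ^ 2 : ℝ) : ℂ) * Vf k s + Bf k s).re) (Ioo 0 T) volume :=
    fun k => (((h.integrableOn_inner_symbT (Visc4.conj G₀ 𝔸) k).const_mul _).add (h.integrableOn_modeRHS_self k)).re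
  -- all one-mode identities at once, and the flux identification
  have hmodes := ae_all_iff.2 fun k => h.ae_sq_norm_mFourierCoeff_eq_constFrame hw₀ hdiv₀ k
  have hflux' : ∀ᵐ s ∂(volume : Measure ℝ), s ∈ Ioo 0 T → ∀ N : ℕ,
      Fl N s = ∑ k ∈ FunctionSpaces.Torus.freqBall N, (Bf k s).re :=
    (ae_restrict_iff' measurableSet_Ioo).1 h.ae_galerkinFlux_eq_sum
  filter_upwards [hmodes, ae_restrict_mem measurableSet_Ioo] with t ht htT
  intro N
  have hsub : Ioc 0 t ⊆ Ioo 0 T := Ioc_subset_Ioo_right htT.2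
  -- sum the one-mode identities over the ball
  have hsum : ∑ k ∈ FunctionSpaces.Torus.freqBall N, ‖X k t‖ ^ 2 =
      ∑ k ∈ FunctionSpaces.Torus.freqBall N, (‖X₀ k‖ ^ 2 +
        2 * ∫ s in Ioc 0 t, ((-(4 * Real.pi ^ 2 : ℝ) : ℂ) * Vf k s + Bf k s).re) :=
    Finset.sum_congr rfl fun k _ => ht k
  rw [Finset.sum_add_distrib, ← Finset.mul_sum,
    ← integral_finsetSum _ (fun k _ => (hHi k).mono_set hsub)] at hsum
  -- split the summed integrand
  have hsplit : ∫ s in Ioc 0 t, ∑ k ∈ FunctionSpaces.Torus.freqBall N, ((-(4 * Real.pi ^ 2 : ℝ) : ℂ) * Vf k s + Bf k s).re =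
      (∫ s in Ioc 0 t, Fl N s) - ∫ s in Ioc 0 t, 4 * Real.pi ^ 2 * ∑ k ∈ FunctionSpaces.Torus.freqBall N, (Vf k s).re := by
    have hQi : IntegrableOn (fun s => 4 * Real.pi ^ 2 * ∑ k ∈ FunctionSpaces.Torus.freqBall N, (Vf k s).re)
        (Ioc 0 t) volume := (h.integrableOn_symbForm (Visc4.conj G₀ 𝔸) N).mono_set hsub
    have hFli : IntegrableOn (Fl N) (Ioc 0 t) volume := (h.integrableOn_galerkinFlux N).mono_set hsub
    rw [← integral_sub hFli hQi]
    refine setIntegral_congr_ae measurableSet_Ioc ?_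
    filter_upwards [hflux'] with s hs hsI
    rw [hs (hsub hsI) N, Finset.mul_sum, ← Finset.sum_sub_distrib]
    refine Finset.sum_congr rfl fun k _ => ?_
    rw [Complex.add_re, neg_mul, Complex.neg_re, Complex.re_ofReal_mul]
    ring
  rw [hsplit] at hsum
  rw [hX] at hsum
  simp only at hsum
  linarith

/-! ## The transport flux for `A = 0`: remainder form and bound (any frame) -/

/-- **The transport flux of the truncated identity, for `A = 0`, is a remainder** controlled by the
Parseval tail and the truncated dissipation (any frame): for a carrier bounded by `M` a.e., for a.e.
`s ∈ (0,T)`,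
`Flux_N(s) = R_N(s) = ∫⟪w(s) - P_N w(s), (b(s)·∇)P_N w(s)⟫`,
`|R_N(s)| ≤ d M (∫‖w(s) - P_N w(s)‖²)^{1/2} (‖∇P_N w(s)‖₂²)^{1/2}`
(`∫⟪P_N w,(b·∇)P_N w⟫ = 0` for the weakly divergence-free carrier). [cite: RobinsonRodrigoSadowski2016, §4.2 (4.20)] -/
theorem ae_galerkinFlux_eq_remainder (h : IsWeakTensorPassiveVectorDistortedOn 0 T 𝔸 b G w₀ w) {M : ℝ} (hM : 0 ≤ M)
    (hbM : ∀ᵐ s ∂(volume.restrict (Ioo 0 T)), ∀ᵐ x ∂volume, ‖b s x‖ ≤ M) (N : ℕ) :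
    ∀ᵐ s ∂(volume.restrict (Ioo 0 T)),
      ((∫ x, ⟪w s x, FunctionSpaces.Torus.convect (b s) (FunctionSpaces.Torus.fourierTruncate N (w s)) x⟫_ℝ) +
          (0 : ℝ) * ∫ x, ⟪b s x, FunctionSpaces.Torus.convect (w s) (FunctionSpaces.Torus.fourierTruncate N (w s)) x⟫_ℝ =
        ∫ x, ⟪w s x - FunctionSpaces.Torus.fourierTruncate N (w s) x,
            FunctionSpaces.Torus.convect (b s) (FunctionSpaces.Torus.fourierTruncate N (w s)) x⟫_ℝ) ∧
      |∫ x, ⟪w s x - FunctionSpaces.Torus.fourierTruncate N (w s) x,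
          FunctionSpaces.Torus.convect (b s) (FunctionSpaces.Torus.fourierTruncate N (w s)) x⟫_ℝ| ≤
        Fintype.card d * M * Real.sqrt (∫ x, ‖w s x - FunctionSpaces.Torus.fourierTruncate N (w s) x‖ ^ 2) *
          Real.sqrt ((FunctionSpaces.Torus.eGradNormSq (FunctionSpaces.Torus.fourierTruncate N (w s))).toReal) := by
  filter_upwards [h.ae_integrable_slice, h.ae_memLp_two, h.ae_isWeaklyDivFree_carrier, h.ae_aestronglyMeasurable_slice, hbM]
    with s hs hs2 hbdiv hsm hbs
  have hbint : Integrable (b s) volume := Integrable.of_bound hsm.2 M hbs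
  refine ⟨?_, ?_⟩
  · rw [zero_mul, add_zero, integral_inner_convect_fourierTruncate_eq_remainder hbint hbdiv hs.2.1 N]
  · have hv : MemLp (fun x => w s x - FunctionSpaces.Torus.fourierTruncate N (w s) x) 2 volume :=
      hs2.sub (FunctionSpaces.Torus.memLp_fourierTruncate N _ 2)
    have hb := abs_integral_inner_convect_le_of_norm_le (u := b s) hv hM hbs
      (FunctionSpaces.Torus.isSmooth_fourierTruncate N (w s))
    rwa [gradNormSq_fourierTruncate] at hb

/-! ## Coercivity and monotonicity of the truncated twisted symbol form (constant frame) -/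

/-- The modes of a constant-frame distorted weak solution are transversal to the twisted frequencies,
for a.e. `s`, every `k`: `rdot (twistFreq G₀ k) (ŵ(s)(k)) = 0`.
[cite: RobinsonRodrigoSadowski2016, Ex. 2.14 (solution p. 310)] [cite: ArmstrongVicol2025, §4.1 (PDF p. 34)] -/
theorem ae_rdot_twistFreq_mFourierCoeff_eq_zero (h : IsWeakTensorPassiveVectorDistortedOn A T 𝔸 b (fun _ _ => G₀) w₀ w) :
    ∀ᵐ s ∂(volume.restrict (Ioo 0 T)), ∀ k : d → ℤ,
      rdot (twistFreq G₀ k) (mFourierCoeff (FunctionSpaces.EuclideanSpace.complexify ∘ w s) k) = 0 := by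
  filter_upwards [h.ae_sum_vecMul_mul_mFourierCoeff_eq_zero] with s hs
  intro k
  rw [rdot_twistFreq]
  exact hs k

/-- **Coercivity of the truncated twisted symbol form against the truncated dissipation** (constant
non-degenerate frame). In a window `NearIso 𝔸 lo hi` with `0 ≤ lo` and for a frame with
`c |k|² ≤ |G₀ᵀk|²` for all `k` (any real `c`), for a.e. `s ∈ (0,T)` and every `N`:
`(lo c) ‖∇P_N w(s)‖₂² ≤ Q_N(s) = 4π² ∑_{|k|≤N} Re ⟪ŵ(s)(k), T_{𝔸^{G₀}}(k) ŵ(s)(k)⟫`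
(`‖∇P_N w(s)‖₂² = 4π² ∑_{|k|≤N} |k|² ‖ŵ(s)(k)‖²` and `lo|G₀ᵀk|²‖z‖² ≤ Re ⟪z, T_{𝔸^{G₀}}(k)z⟫` on `(G₀ᵀk)^⊥`,
where the modes of a weak solution lie for a.e. `s`). [cite: Giaquinta1983MultipleIntegrals, Ch. III §2 eq. (2.2)]
[cite: ArmstrongVicol2025, §4.1 (PDF p. 34)] [cite: Frisch1995Turbulence, §9.6.3 eq. (9.57) p. 233] -/
theorem ae_lo_mul_le_symbForm_constFrame (h : IsWeakTensorPassiveVectorDistortedOn A T 𝔸 b (fun _ _ => G₀) w₀ w)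
    {lo hi : ℝ} (h𝔸 : NearIso 𝔸 lo hi) (hlo : 0 ≤ lo)
    {c : ℝ} (hG : ∀ k : d → ℤ, c * FunctionSpaces.Torus.freqNormSq k ≤ ∑ a, twistFreq G₀ k a ^ 2) :
    ∀ᵐ s ∂(volume.restrict (Ioo 0 T)), ∀ N : ℕ,
      lo * c * (FunctionSpaces.Torus.eGradNormSq (FunctionSpaces.Torus.fourierTruncate N (w s))).toReal ≤
        4 * Real.pi ^ 2 * ∑ k ∈ FunctionSpaces.Torus.freqBall N,
          (⟪mFourierCoeff (FunctionSpaces.EuclideanSpace.complexify ∘ w s) k,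
            symbT (Visc4.conj G₀ 𝔸) k (mFourierCoeff (FunctionSpaces.EuclideanSpace.complexify ∘ w s) k)⟫_ℂ).re := by
  filter_upwards [h.ae_rdot_twistFreq_mFourierCoeff_eq_zero, h.ae_integrable_slice] with s hs hsi
  intro N
  rw [FunctionSpaces.Torus.fourierTruncate_eq,
    FunctionSpaces.Torus.toReal_eGradNormSq_realTrigPoly FunctionSpaces.Torus.neg_mem_freqBall_of_mem
      (FunctionSpaces.Torus.isConjSymm_mFourierCoeff hsi.1)]
  have e : lo * c * (4 * Real.pi ^ 2 * ∑ k ∈ FunctionSpaces.Torus.freqBall N,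
      FunctionSpaces.Torus.freqNormSq k * ‖mFourierCoeff (FunctionSpaces.EuclideanSpace.complexify ∘ w s) k‖ ^ 2) =
      4 * Real.pi ^ 2 * ∑ k ∈ FunctionSpaces.Torus.freqBall N,
        lo * (c * FunctionSpaces.Torus.freqNormSq k) * ‖mFourierCoeff (FunctionSpaces.EuclideanSpace.complexify ∘ w s) k‖ ^ 2 := by
    rw [Finset.mul_sum, Finset.mul_sum, Finset.mul_sum]
    exact Finset.sum_congr rfl fun k _ => by ring
  rw [e]
  refine mul_le_mul_of_nonneg_left (Finset.sum_le_sum fun k _ => ?_) (by positivity)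
  have hco := lo_mul_le_re_inner_symbT_conj h𝔸 G₀ (hs k)
  have hz : 0 ≤ ‖mFourierCoeff (FunctionSpaces.EuclideanSpace.complexify ∘ w s) k‖ ^ 2 := sq_nonneg _
  have h1 : lo * (c * FunctionSpaces.Torus.freqNormSq k) ≤ lo * ∑ a, twistFreq G₀ k a ^ 2 :=
    mul_le_mul_of_nonneg_left (hG k) hlo
  calc lo * (c * FunctionSpaces.Torus.freqNormSq k) * ‖mFourierCoeff (FunctionSpaces.EuclideanSpace.complexify ∘ w s) k‖ ^ 2
      ≤ lo * (∑ a, twistFreq G₀ k a ^ 2) * ‖mFourierCoeff (FunctionSpaces.EuclideanSpace.complexify ∘ w s) k‖ ^ 2 :=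
        mul_le_mul_of_nonneg_right h1 hz
    _ = lo * ((∑ a, twistFreq G₀ k a ^ 2) * ‖mFourierCoeff (FunctionSpaces.EuclideanSpace.complexify ∘ w s) k‖ ^ 2) := by
        ring
    _ ≤ _ := hco

/-- **Coercivity of the truncated twisted symbol form against the truncated energy on mean-zero slices**
(constant non-degenerate frame): if moreover `ŵ(s)(0) = 0`, then `4π² (lo c) ∑_{|k|≤N} ‖ŵ(s)(k)‖² ≤ Q_N(s)`
(`|G₀ᵀk|² ≥ c|k|² ≥ c` for `k ≠ 0`). [cite: Giaquinta1983MultipleIntegrals, Ch. III §2 eq. (2.2)]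
[cite: ArmstrongVicol2025, §4.1 (PDF p. 34)] -/
theorem ae_lo_mul_sum_sq_norm_le_symbForm_constFrame (h : IsWeakTensorPassiveVectorDistortedOn A T 𝔸 b (fun _ _ => G₀) w₀ w)
    {lo hi : ℝ} (h𝔸 : NearIso 𝔸 lo hi) (hlo : 0 ≤ lo)
    {c : ℝ} (hc : 0 ≤ c) (hG : ∀ k : d → ℤ, c * FunctionSpaces.Torus.freqNormSq k ≤ ∑ a, twistFreq G₀ k a ^ 2) :
    ∀ᵐ s ∂(volume.restrict (Ioo 0 T)), mFourierCoeff (FunctionSpaces.EuclideanSpace.complexify ∘ w s) 0 = 0 →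
      ∀ N : ℕ, 4 * Real.pi ^ 2 * (lo * c) *
          ∑ k ∈ FunctionSpaces.Torus.freqBall N, ‖mFourierCoeff (FunctionSpaces.EuclideanSpace.complexify ∘ w s) k‖ ^ 2 ≤
        4 * Real.pi ^ 2 * ∑ k ∈ FunctionSpaces.Torus.freqBall N,
          (⟪mFourierCoeff (FunctionSpaces.EuclideanSpace.complexify ∘ w s) k,
            symbT (Visc4.conj G₀ 𝔸) k (mFourierCoeff (FunctionSpaces.EuclideanSpace.complexify ∘ w s) k)⟫_ℂ).re := by
  filter_upwards [h.ae_rdot_twistFreq_mFourierCoeff_eq_zero] with s hs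
  intro h0 N
  rw [mul_assoc, Finset.mul_sum]
  refine mul_le_mul_of_nonneg_left (Finset.sum_le_sum fun k _ => ?_) (by positivity)
  by_cases hk : k = 0
  · subst hk
    rw [h0]
    simp
  · have h1 := FunctionSpaces.Torus.one_le_freqNormSq_of_ne_zero hk
    have hco := lo_mul_le_re_inner_symbT_conj h𝔸 G₀ (hs k)
    have hGk := hG k
    have hz : 0 ≤ ‖mFourierCoeff (FunctionSpaces.EuclideanSpace.complexify ∘ w s) k‖ ^ 2 := sq_nonneg _
    have h2 : c ≤ ∑ a, twistFreq G₀ k a ^ 2 := by nlinarith [hGk, h1, hc]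
    have h3 : lo * c ≤ lo * ∑ a, twistFreq G₀ k a ^ 2 := mul_le_mul_of_nonneg_left h2 hlo
    calc lo * c * ‖mFourierCoeff (FunctionSpaces.EuclideanSpace.complexify ∘ w s) k‖ ^ 2
        ≤ lo * (∑ a, twistFreq G₀ k a ^ 2) * ‖mFourierCoeff (FunctionSpaces.EuclideanSpace.complexify ∘ w s) k‖ ^ 2 :=
          mul_le_mul_of_nonneg_right h3 hz
      _ = lo * ((∑ a, twistFreq G₀ k a ^ 2) * ‖mFourierCoeff (FunctionSpaces.EuclideanSpace.complexify ∘ w s) k‖ ^ 2) := by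
          ring
      _ ≤ _ := hco

/-- The terms of the twisted symbol form are nonnegative in a window with `0 ≤ lo` (constant frame, any
`G₀`): for a.e. `s`, every `k`, `0 ≤ Re ⟪ŵ(s)(k), T_{𝔸^{G₀}}(k) ŵ(s)(k)⟫`.
[cite: Giaquinta1983MultipleIntegrals, Ch. III §2 eq. (2.2)] [cite: ArmstrongVicol2025, §4.1 (PDF p. 34)] -/
theorem ae_re_inner_symbT_nonneg_constFrame (h : IsWeakTensorPassiveVectorDistortedOn A T 𝔸 b (fun _ _ => G₀) w₀ w)
    {lo hi : ℝ} (h𝔸 : NearIso 𝔸 lo hi) (hlo : 0 ≤ lo) :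
    ∀ᵐ s ∂(volume.restrict (Ioo 0 T)), ∀ k : d → ℤ,
      0 ≤ (⟪mFourierCoeff (FunctionSpaces.EuclideanSpace.complexify ∘ w s) k,
        symbT (Visc4.conj G₀ 𝔸) k (mFourierCoeff (FunctionSpaces.EuclideanSpace.complexify ∘ w s) k)⟫_ℂ).re := by
  filter_upwards [h.ae_rdot_twistFreq_mFourierCoeff_eq_zero] with s hs
  intro k
  have hco := lo_mul_le_re_inner_symbT_conj h𝔸 G₀ (hs k)
  exact (mul_nonneg hlo (mul_nonneg (Finset.sum_nonneg fun a _ => sq_nonneg _) (sq_nonneg _))).trans hco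

/-- **The truncated twisted symbol form is nondecreasing in `N`** (nonnegative terms), for a.e. `s`
(constant frame). [cite: Giaquinta1983MultipleIntegrals, Ch. III §2 eq. (2.2)] -/
theorem ae_symbForm_mono_constFrame (h : IsWeakTensorPassiveVectorDistortedOn A T 𝔸 b (fun _ _ => G₀) w₀ w)
    {lo hi : ℝ} (h𝔸 : NearIso 𝔸 lo hi) (hlo : 0 ≤ lo) :
    ∀ᵐ s ∂(volume.restrict (Ioo 0 T)), Monotone fun N : ℕ =>
      4 * Real.pi ^ 2 * ∑ k ∈ FunctionSpaces.Torus.freqBall N,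
        (⟪mFourierCoeff (FunctionSpaces.EuclideanSpace.complexify ∘ w s) k,
          symbT (Visc4.conj G₀ 𝔸) k (mFourierCoeff (FunctionSpaces.EuclideanSpace.complexify ∘ w s) k)⟫_ℂ).re := by
  filter_upwards [h.ae_re_inner_symbT_nonneg_constFrame h𝔸 hlo] with s hs
  intro N N' hNN'
  exact mul_le_mul_of_nonneg_left
    (Finset.sum_le_sum_of_subset_of_nonneg (FunctionSpaces.Torus.freqBall_mono hNN') fun k _ _ => hs k)
    (by positivity)

end IsWeakTensorPassiveVectorDistortedOn

end Torus

end Literature.Analysis.FluidPDE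

end
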